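import Summits.NavierStokesRegularity.NavierStokesRegularity.Theses.TypeIIInviscidRelaxation
import Summits.NavierStokesRegularity.NavierStokesRegularity.Theorems.TypeIIInviscidRelaxationAxisymSwirlRegularCoreStrainNearTop
import Summits.NavierStokesRegularity.NavierStokesRegularity.Theorems.TypeIIInviscidRelaxationOneSidedRadialCriterionIffCorePartialTypeI
import HarnessLib

/-!
# Crux `OneSidedRadialCriterion` (stmt-NavierStokesRegularity-19059): the third door
# `subcritical_core_reynolds` carries exactly the strength of the crux, BY NAME

`--supports stmt-NavierStokesRegularity-19059` (helper file; theorems only, no definitions, no `sorry`).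

The registered line `Cruxes/OneSidedRadialCriterion/Lines/subcritical_core_reynolds.lean` (skeleton `6f394aafbaa719b5`)
localises the one-sided radial inflow criterion (gate `r u_r ≥ -Cν` on an axis tube, ANY `C` ⇒ extension past `T`)
to ONE research stub `stub_subcriticalCoreReynolds` (SCR): under the gate there is a SUBCRITICAL level `d₀ < 2` such
that for every core width `ξ > 0`, from some `T₁ < T` on, `u_r ≥ -ν d₀/r` at the core points `0 < r < δ`,
`r < ξ√(ν(T-t))`.  The line proves SCR ⇒ crux; the converse is prose there.  Here, in kernel (nothing is closed):
* `subcriticalCore_of_velocityBound` — a velocity bound near the top pushes the core inflow Reynolds number below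
  ANY level `d₀ > 0` near `T`, in every parabolic core (`r u_r⁻ ≤ B r < Bξ√(ν(T-t)) ≤ ν d₀`);
* `subcriticalCoreReynolds_of_gate_lt_two` — for `C < 2` the stub's conclusion is IMMEDIATE from the gate
  (`d₀ = max C 1`, every `t`): the stub has content only for `C ≥ 2`;
* `vanishingCoreReynolds_of_hasSmoothExtensionPast` — NECESSITY: a solution of the standing class extending past `T`
  is bounded on `[0,T) × ℝ³` (`CorePartialTypeI.exists_bound_of_hasSmoothExtensionPast`), so SCR holds at EVERY level;
* `twoLevel_tube_nearTop_of_coreLevel` — the line's §1 (two-level criterion, any core level `d₀ < 2`, thin tube,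
  late start), re-proved here because a `Cruxes/` skeleton is not importable; `hasSmoothExtensionPast_of_/iff_…` —
  the composition and the equivalence PER SOLUTION;
* `oneSidedRadialCriterion_iff_subcriticalCoreReynolds` — the EQUIVALENCE certificate, BY NAME; and
  `oneSidedRadialCriterion_iff_vanishingCoreReynolds` — the crux is ALSO the formally strongest door "core Reynolds
  number `→ 0`": the self-improvement `C ↦ d₀ < 2` and the full decay `C ↦ 0⁺` are one statement.  (Door 1, CPT,
  `CorePartialTypeI.oneSidedRadialCriterion_iff_corePartialTypeI`, is then equivalent to door 3 by one `rw`.)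

HONEST FRAMING: EQUIVALENCE / re-typing layer (fixed-point certificate for the third door).  SCR is open exactly for
gate constants `C ≥ 2` — the content of ⟨19059⟩; nothing here closes ⟨19059⟩ or ⟨1964⟩, and nothing about
Navier–Stokes regularity is claimed.  References: KNSS 2009 §5 [KochNadirashviliSereginSverak2009]; Zhang 2026
(arXiv:2604.07785) [Zhang2026PartialTypeI]; tree `RadialInflowCoreReynolds.exists_coreWidth_twoLevelReynolds`.
-/

noncomputable section

open Set Real Literature.Analysis.FluidPDE

namespace Summit.NavierStokesRegularity.NavierStokesRegularity.Theorems.SubcriticalCoreReynolds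

-- the problem directory repeats the summit name (`NavierStokesRegularity/NavierStokesRegularity`)
set_option linter.dupNamespace false

open Summit.NavierStokesRegularity.NavierStokesRegularity.Theorems RadialInflowCoreReynolds RadialInflowSimilarity
open Summit.NavierStokesRegularity.NavierStokesRegularity.Theorems.ScenarioCensus.LogGate
open Summit.NavierStokesRegularity.NavierStokesRegularity.Theses.TypeIIInviscidRelaxation (OneSidedRadialCriterion)

/-! ### §1 Sufficient conditions for the stub's conclusion, per solution -/

/-- **A velocity bound near the top makes the core inflow Reynolds number small near `T`, at every level.**
If `‖u(t,x)‖ ≤ B` for `t ∈ [0,T)` with `t ≥ T₀` (`T₀ < T`), then for every level `d₀ > 0` and every core width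
`ξ > 0` there is `T₁ < T` such that `u_r ≥ -ν d₀ / r` at all points `0 < r < ξ√(ν(T-t))`, `T₁ ≤ t < T`:
indeed `u_r ≥ -‖u‖ ≥ -B` and `B r < B ξ√(ν(T-t)) ≤ ν d₀` once `T - t ≤ ν d₀²/(B²ξ²)`. [folklore] -/
theorem subcriticalCore_of_velocityBound {ν T T₀ B : ℝ} (hν : 0 < ν) (hT₀ : T₀ < T)
    {u : ℝ → EuclideanSpace ℝ (Fin 3) → EuclideanSpace ℝ (Fin 3)}
    (hB : ∀ t ∈ Ico 0 T, T₀ ≤ t → ∀ x, ‖u t x‖ ≤ B) {d₀ : ℝ} (hd0 : 0 < d₀) {ξ : ℝ} (hξ : 0 < ξ) :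
    ∃ T₁ : ℝ, T₁ < T ∧ ∀ t ∈ Ico 0 T, T₁ ≤ t → ∀ x : EuclideanSpace ℝ (Fin 3), 0 < cylRadius x →
      cylRadius x < ξ * √(ν * (T - t)) → -(ν * d₀ / cylRadius x) ≤ radialVelocity (u t) x := by
  set B' : ℝ := max B 0 + 1 with hB'_def
  have hB'0 : 0 < B' := by rw [hB'_def]; positivity
  have hBB' : B ≤ B' := by rw [hB'_def]; linarith [le_max_left B 0]
  set τ : ℝ := ν * d₀ ^ 2 / (B' ^ 2 * ξ ^ 2) with hτ_def
  have hτ : 0 < τ := by rw [hτ_def]; positivity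
  refine ⟨max T₀ (T - τ), max_lt hT₀ (by linarith), fun t ht hT₁t x hx hxcore => ?_⟩
  have hT₀t : T₀ ≤ t := (le_max_left _ _).trans hT₁t
  have hτt : T - t ≤ τ := by linarith [(le_max_right T₀ (T - τ)).trans hT₁t]
  -- `√(ν(T-t)) ≤ ν d₀/(B' ξ)`
  have hkey : √(ν * (T - t)) ≤ ν * d₀ / (B' * ξ) := by
    have h1 : ν * (T - t) ≤ (ν * d₀ / (B' * ξ)) ^ 2 := by
      have e : (ν * d₀ / (B' * ξ)) ^ 2 = ν * τ := by
        rw [hτ_def]; field_simp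
      rw [e]
      exact mul_le_mul_of_nonneg_left hτt hν.le
    calc √(ν * (T - t)) ≤ √((ν * d₀ / (B' * ξ)) ^ 2) := Real.sqrt_le_sqrt h1
      _ = ν * d₀ / (B' * ξ) := Real.sqrt_sq (by positivity)
  -- hence `B' r < ν d₀`
  have hr : cylRadius x < ν * d₀ / B' := by
    calc cylRadius x < ξ * √(ν * (T - t)) := hxcore
      _ ≤ ξ * (ν * d₀ / (B' * ξ)) := mul_le_mul_of_nonneg_left hkey hξ.le
      _ = ν * d₀ / B' := by field_simp
  have hr' : B' * cylRadius x < ν * d₀ := by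
    rw [lt_div_iff₀ hB'0] at hr; linarith
  have hu : ‖u t x‖ ≤ B' := (hB t ht hT₀t x).trans hBB'
  have h1 := neg_norm_le_radialVelocity (u t) hx
  have h2 : ‖u t x‖ < ν * d₀ / cylRadius x := by
    rw [lt_div_iff₀ hx]
    calc ‖u t x‖ * cylRadius x ≤ B' * cylRadius x := mul_le_mul_of_nonneg_right hu (cylRadius_nonneg x)
      _ < ν * d₀ := hr'
  linarith

/-- **A bound on `[0,T) × ℝ³` gives the stub's conclusion at every level** (`∀ d₀ > 0 ∀ ξ > 0 ∃ T₁ < T …`, the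
extra restriction `r < δ` being idle). [folklore] -/
theorem vanishingCoreReynolds_of_bound {ν T B δ : ℝ} (hν : 0 < ν) (hT : 0 < T)
    {u : ℝ → EuclideanSpace ℝ (Fin 3) → EuclideanSpace ℝ (Fin 3)} (hB : ∀ t ∈ Ico 0 T, ∀ x, ‖u t x‖ ≤ B) :
    ∀ d₀ : ℝ, 0 < d₀ → ∀ ξ : ℝ, 0 < ξ → ∃ T₁ : ℝ, T₁ < T ∧
      ∀ t ∈ Ico 0 T, T₁ ≤ t → ∀ x : EuclideanSpace ℝ (Fin 3), 0 < cylRadius x → cylRadius x < δ →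
        cylRadius x < ξ * √(ν * (T - t)) → -(ν * d₀ / cylRadius x) ≤ radialVelocity (u t) x := by
  intro d₀ hd0 ξ hξ
  obtain ⟨T₁, hT₁, h⟩ := subcriticalCore_of_velocityBound (T₀ := 0) hν hT (fun t ht _ x => hB t ht x) hd0 hξ
  exact ⟨T₁, hT₁, fun t ht hT₁t x hx _ hxcore => h t ht hT₁t x hx hxcore⟩

/-- **Below the critical constant the stub is immediate from the gate** (no PDE input): `r u_r ≥ -Cν` with `C < 2`
on `{r < δ}` gives the level `d₀ = max C 1 < 2` at EVERY time and every core width.  So `stub_subcriticalCoreReynolds`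
has content only for gate constants `C ≥ 2`, matching `ScenarioCensus.LogGate.oneSidedRadialCriterion_iff_geTwo`.
[folklore] -/
theorem subcriticalCoreReynolds_of_gate_lt_two {ν T C δ : ℝ} (hν : 0 < ν) (hC : C < 2)
    {u : ℝ → EuclideanSpace ℝ (Fin 3) → EuclideanSpace ℝ (Fin 3)}
    (hgate : ∀ t ∈ Ico 0 T, ∀ x : EuclideanSpace ℝ (Fin 3), cylRadius x < δ →
      -(C * ν) ≤ x 0 * u t x 0 + x 1 * u t x 1) :
    ∃ d₀ : ℝ, 0 < d₀ ∧ d₀ < 2 ∧ ∀ ξ : ℝ, 0 < ξ → ∃ T₁ : ℝ, T₁ < T ∧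
      ∀ t ∈ Ico 0 T, T₁ ≤ t → ∀ x : EuclideanSpace ℝ (Fin 3), 0 < cylRadius x → cylRadius x < δ →
        cylRadius x < ξ * √(ν * (T - t)) → -(ν * d₀ / cylRadius x) ≤ radialVelocity (u t) x := by
  refine ⟨max C 1, lt_of_lt_of_le one_pos (le_max_right _ _), max_lt hC (by norm_num), fun ξ _ =>
    ⟨T - 1, by linarith, fun t ht _ x hx hxδ _ => ?_⟩⟩
  have h1 := hgate t ht x hxδ
  rw [radialVelocity_eq_div']
  have h2 : -(ν * max C 1 / cylRadius x) ≤ -(C * ν) / cylRadius x := by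
    rw [neg_div]
    refine neg_le_neg (div_le_div_of_nonneg_right ?_ hx.le)
    nlinarith [le_max_left C 1]
  exact h2.trans (div_le_div_of_nonneg_right h1 hx.le)

/-- **NECESSITY of the stub, per solution.** In the standing class (classical on `[0,T)`, Leray–Hopf, bounded on
closed sub-slabs, axisymmetric slices) a solution that extends smoothly past `T` is bounded on `[0,T) × ℝ³`
(`CorePartialTypeI.exists_bound_of_hasSmoothExtensionPast`), hence its core inflow Reynolds number sinks below EVERY
level `d₀ > 0` near `T`, in every parabolic core. [folklore assembly of tree theorems] -/
theorem vanishingCoreReynolds_of_hasSmoothExtensionPast {ν T δ : ℝ} (hν : 0 < ν) (hT : 0 < T)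
    {u : ℝ → EuclideanSpace ℝ (Fin 3) → EuclideanSpace ℝ (Fin 3)} {p : ℝ → EuclideanSpace ℝ (Fin 3) → ℝ}
    (hcl : IsClassicalNSSolutionOn (Ico 0 T) ν 0 u p) (hLH : IsLerayHopfOn T ν 0 (u 0) u)
    (hbd : ∀ T' < T, ∃ M : ℝ, ∀ t ∈ Icc 0 T', ∀ x, ‖u t x‖ ≤ M)
    (hax : ∀ t ∈ Ico 0 T, IsAxisymmetric (u t)) (hext : HasSmoothExtensionPast ν 0 u T) :
    ∀ d₀ : ℝ, 0 < d₀ → ∀ ξ : ℝ, 0 < ξ → ∃ T₁ : ℝ, T₁ < T ∧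
      ∀ t ∈ Ico 0 T, T₁ ≤ t → ∀ x : EuclideanSpace ℝ (Fin 3), 0 < cylRadius x → cylRadius x < δ →
        cylRadius x < ξ * √(ν * (T - t)) → -(ν * d₀ / cylRadius x) ≤ radialVelocity (u t) x := by
  obtain ⟨B, hB⟩ := CorePartialTypeI.exists_bound_of_hasSmoothExtensionPast hν hT hcl hLH hbd hax hext
  exact vanishingCoreReynolds_of_bound hν hT hB

/-! ### §2 The two-level criterion with core level `d₀ < 2`, thin tube, late start (the line's §1) -/

/-- **Two-level inflow criterion with an arbitrary subcritical core level, thin tube, near the blow-up time**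
(the tree's `RadialInflowCoreStrain.exists_coreWidth_twoLevel_tube_nearTop` is the case `d₀ = 1`; this is §1 of the
line file `Lines/subcritical_core_reynolds.lean`, re-proved verbatim so that it is importable).  For every
`0 < d₀ < 2` and `Λ₀ > 0` there is a core width `ξ₀ > 0` such that in the standing class (with the sub-slab bound):
if for SOME `δ > 0` and SOME `T₁ < T` the radial velocity obeys, on `{0 < r ≤ δ} × [T₁,T)`, `u_r ≥ -ν d₀/r` where
`r < ξ₀√(ν(T-t))` and `u_r ≥ -νΛ₀/r` where `r ≥ ξ₀√(ν(T-t))`, then the solution extends smoothly past `T`.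
Proof: on a thin tube `{0 < r ≤ c}` both clauses hold from `t = 0` (sub-slab bound), outer level `max Λ₀ d₀`; Leray's
similarity with `c` maps them onto the unit-tube hypotheses of `exists_coreWidth_twoLevelReynolds`. [new; line §1] -/
theorem twoLevel_tube_nearTop_of_coreLevel {d₀ Λ₀ : ℝ} (hd0 : 0 < d₀) (hd2 : d₀ < 2) (hΛ : 0 < Λ₀) :
    ∃ ξ₀ : ℝ, 0 < ξ₀ ∧ ∀ (ν T : ℝ), 0 < ν → 0 < T →
      ∀ (u : ℝ → EuclideanSpace ℝ (Fin 3) → EuclideanSpace ℝ (Fin 3)) (p : ℝ → EuclideanSpace ℝ (Fin 3) → ℝ),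
      IsClassicalNSSolutionOn (Ico 0 T) ν 0 u p → IsLerayHopfOn T ν 0 (u 0) u → HasRapidSpatialDecay (u 0) →
      (∀ T' < T, ∃ M : ℝ, ∀ t ∈ Icc 0 T', ∀ x, ‖u t x‖ ≤ M) → (∀ t ∈ Ico 0 T, IsAxisymmetric (u t)) →
      ∀ (δ T₁ : ℝ), 0 < δ → T₁ < T →
      (∀ t ∈ Ico 0 T, T₁ ≤ t → ∀ x : EuclideanSpace ℝ (Fin 3), 0 < cylRadius x → cylRadius x ≤ δ →
        ξ₀ * √(ν * (T - t)) ≤ cylRadius x → -(ν * Λ₀ / cylRadius x) ≤ radialVelocity (u t) x) →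
      (∀ t ∈ Ico 0 T, T₁ ≤ t → ∀ x : EuclideanSpace ℝ (Fin 3), 0 < cylRadius x → cylRadius x ≤ δ →
        cylRadius x < ξ₀ * √(ν * (T - t)) → -(ν * d₀ / cylRadius x) ≤ radialVelocity (u t) x) →
      HasSmoothExtensionPast ν 0 u T := by
  have hΛ1 : 0 < max Λ₀ d₀ := lt_of_lt_of_le hd0 (le_max_right _ _)
  obtain ⟨ξ₀, hξ₀, H⟩ := exists_coreWidth_twoLevelReynolds (d₀ := d₀) (Λ₀ := max Λ₀ d₀) hd0 hd2 hΛ1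
  refine ⟨ξ₀, hξ₀, fun ν T hν hT u p hcl hLH hdec hbd hax δ T₁ hδ hT₁ hfar hcore => ?_⟩
  -- the early bound and the thin tube
  set T₀ : ℝ := max T₁ 0 with hT₀_def
  have hT₀T : T₀ < T := max_lt hT₁ hT
  obtain ⟨B, hB⟩ := hbd T₀ hT₀T
  set B' : ℝ := max B 0 + 1 with hB'_def
  have hB'0 : 0 < B' := by rw [hB'_def]; positivity
  have hBB' : B ≤ B' := by rw [hB'_def]; linarith [le_max_left B 0]
  set c : ℝ := min δ (d₀ * ν / B') with hc_def
  have hc : 0 < c := lt_min hδ (div_pos (mul_pos hd0 hν) hB'0)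
  have hcδ : c ≤ δ := min_le_left _ _
  have hcB : c * B' ≤ d₀ * ν := by
    have h1 : c ≤ d₀ * ν / B' := min_le_right _ _
    rwa [le_div_iff₀ hB'0] at h1
  -- both clauses on the thin tube `{0 < r ≤ c}` from `t = 0`
  have hearly : ∀ t ∈ Ico 0 T, t < T₀ → ∀ x : EuclideanSpace ℝ (Fin 3), 0 < cylRadius x → cylRadius x ≤ c →
      -(ν * d₀ / cylRadius x) ≤ radialVelocity (u t) x := by
    intro t ht htT₀ x hx hxc
    have hu : ‖u t x‖ ≤ B := hB t ⟨ht.1, htT₀.le⟩ x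
    have h1 := neg_norm_le_radialVelocity (u t) hx
    have h2 : ‖u t x‖ ≤ ν * d₀ / cylRadius x := by
      rw [le_div_iff₀ hx]
      calc ‖u t x‖ * cylRadius x ≤ B' * c := by
            refine mul_le_mul (hu.trans hBB') hxc (cylRadius_nonneg x) hB'0.le
        _ ≤ ν * d₀ := by linarith [mul_comm c B', mul_comm ν d₀]
    linarith
  have hcore' : ∀ t ∈ Ico 0 T, ∀ x : EuclideanSpace ℝ (Fin 3), 0 < cylRadius x → cylRadius x ≤ c →
      cylRadius x < ξ₀ * √(ν * (T - t)) → -(ν * d₀ / cylRadius x) ≤ radialVelocity (u t) x := by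
    intro t ht x hx hxc hxcore
    by_cases htT₀ : t < T₀
    · exact hearly t ht htT₀ x hx hxc
    · push Not at htT₀
      exact hcore t ht ((le_max_left _ _).trans htT₀) x hx (hxc.trans hcδ) hxcore
  have hfar' : ∀ t ∈ Ico 0 T, ∀ x : EuclideanSpace ℝ (Fin 3), 0 < cylRadius x → cylRadius x ≤ c →
      ξ₀ * √(ν * (T - t)) ≤ cylRadius x → -(ν * max Λ₀ d₀ / cylRadius x) ≤ radialVelocity (u t) x := by
    intro t ht x hx hxc hxfar
    have hmono : -(ν * max Λ₀ d₀ / cylRadius x) ≤ -(ν * d₀ / cylRadius x) := by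
      rw [neg_le_neg_iff]
      refine div_le_div_of_nonneg_right ?_ hx.le
      exact mul_le_mul_of_nonneg_left (le_max_right _ _) hν.le
    by_cases htT₀ : t < T₀
    · exact hmono.trans (hearly t ht htT₀ x hx hxc)
    · push Not at htT₀
      have h1 := hfar t ht ((le_max_left _ _).trans htT₀) x hx (hxc.trans hcδ) hxfar
      have hmono' : -(ν * max Λ₀ d₀ / cylRadius x) ≤ -(ν * Λ₀ / cylRadius x) := by
        rw [neg_le_neg_iff]
        refine div_le_div_of_nonneg_right ?_ hx.le
        exact mul_le_mul_of_nonneg_left (le_max_left _ _) hν.le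
      exact hmono'.trans h1
  -- Leray's similarity with `c`: the thin tube becomes the unit tube
  have hc2 : 0 < c ^ 2 := pow_pos hc 2
  have hTc : 0 < T / c ^ 2 := div_pos hT hc2
  have hmem : ∀ s ∈ Ico 0 (T / c ^ 2), c ^ 2 * s ∈ Ico 0 T := fun s hs =>
    ⟨mul_nonneg hc2.le hs.1, (lt_div_iff₀' hc2).1 hs.2⟩
  obtain ⟨hclw, hLHw, hdecw, haxw⟩ := standingClass_nsRescale hT hcl hLH hdec hax hc
  -- dictionary between `(s, y)` and `(t, x) = (c² s, c y)`
  have hrad : ∀ y : EuclideanSpace ℝ (Fin 3), cylRadius (c • y) = c * cylRadius y := fun y => by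
    rw [cylRadius_smul, abs_of_pos hc]
  have hsqrt : ∀ s : ℝ, s < T / c ^ 2 → c * √(ν * (T / c ^ 2 - s)) = √(ν * (T - c ^ 2 * s)) := by
    intro s hs
    have e : ν * (T - c ^ 2 * s) = c ^ 2 * (ν * (T / c ^ 2 - s)) := by field_simp
    rw [e, Real.sqrt_mul (sq_nonneg c), Real.sqrt_sq hc.le]
  have hextw : HasSmoothExtensionPast ν 0 (nsRescale c u) (T / c ^ 2) := by
    refine H ν (T / c ^ 2) hν hTc (nsRescale c u) (nsRescalePressure c p) hclw hLHw hdecw haxw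
      (fun s hs y hy hy1 hycore => ?_) (fun s hs y hy hy1 hyfar => ?_)
    · -- core clause
      have hx : 0 < cylRadius (c • y) := by rw [hrad]; exact mul_pos hc hy
      have hxc : cylRadius (c • y) ≤ c := by rw [hrad]; nlinarith
      have hxcore : cylRadius (c • y) < ξ₀ * √(ν * (T - c ^ 2 * s)) := by
        rw [hrad, ← hsqrt s hs.2]
        nlinarith [mul_lt_mul_of_pos_left hycore hc]
      have h1 := hcore' (c ^ 2 * s) (hmem s hs) (c • y) hx hxc hxcore
      rw [radialVelocity_nsRescale hc]
      have e : ν * d₀ / cylRadius y = c * (ν * d₀ / cylRadius (c • y)) := by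
        rw [hrad]; field_simp
      rw [e]
      nlinarith
    · -- far clause
      have hx : 0 < cylRadius (c • y) := by rw [hrad]; exact mul_pos hc hy
      have hxc : cylRadius (c • y) ≤ c := by rw [hrad]; nlinarith
      have hxfar : ξ₀ * √(ν * (T - c ^ 2 * s)) ≤ cylRadius (c • y) := by
        rw [hrad, ← hsqrt s hs.2]
        nlinarith [mul_le_mul_of_nonneg_left hyfar hc.le]
      have h1 := hfar' (c ^ 2 * s) (hmem s hs) (c • y) hx hxc hxfar
      rw [radialVelocity_nsRescale hc]
      have e : ν * max Λ₀ d₀ / cylRadius y = c * (ν * max Λ₀ d₀ / cylRadius (c • y)) := by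
        rw [hrad]; field_simp
      rw [e]
      nlinarith
  -- scale back with `c⁻¹`
  exact hasSmoothExtensionPast_of_nsRescale hc hextw

/-- **Per-solution form of the line's composition.** In the standing class, under the gate `r u_r ≥ -Cν` on
`{r < δ} × [0,T)` (any `C`), the stub's conclusion for THIS solution (a subcritical core level `d₀ < 2` in every
parabolic core near `T`) implies `HasSmoothExtensionPast ν 0 u T`: the gate supplies the outer level `max C 1` on
`r ≤ δ/2`, the hypothesis the core level in the core of width `ξ₀(d₀, max C 1)`, and
`twoLevel_tube_nearTop_of_coreLevel` concludes. [new; the line file's `OneSidedRadialCriterion_of`, per solution] -/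
theorem hasSmoothExtensionPast_of_subcriticalCoreReynolds {ν T C δ : ℝ} (hν : 0 < ν) (hT : 0 < T) (hδ : 0 < δ)
    {u : ℝ → EuclideanSpace ℝ (Fin 3) → EuclideanSpace ℝ (Fin 3)} {p : ℝ → EuclideanSpace ℝ (Fin 3) → ℝ}
    (hcl : IsClassicalNSSolutionOn (Ico 0 T) ν 0 u p) (hLH : IsLerayHopfOn T ν 0 (u 0) u)
    (hbd : ∀ T' < T, ∃ M : ℝ, ∀ t ∈ Icc 0 T', ∀ x, ‖u t x‖ ≤ M)
    (hax : ∀ t ∈ Ico 0 T, IsAxisymmetric (u t)) (hdec : HasRapidSpatialDecay (u 0))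
    (hgate : ∀ t ∈ Ico 0 T, ∀ x : EuclideanSpace ℝ (Fin 3), cylRadius x < δ →
      -(C * ν) ≤ x 0 * u t x 0 + x 1 * u t x 1)
    (hSCR : ∃ d₀ : ℝ, 0 < d₀ ∧ d₀ < 2 ∧ ∀ ξ : ℝ, 0 < ξ → ∃ T₁ : ℝ, T₁ < T ∧
      ∀ t ∈ Ico 0 T, T₁ ≤ t → ∀ x : EuclideanSpace ℝ (Fin 3), 0 < cylRadius x → cylRadius x < δ →
        cylRadius x < ξ * √(ν * (T - t)) → -(ν * d₀ / cylRadius x) ≤ radialVelocity (u t) x) :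
    HasSmoothExtensionPast ν 0 u T := by
  obtain ⟨d₀, hd0, hd2, Hξ⟩ := hSCR
  have hΛ : 0 < max C 1 := lt_of_lt_of_le one_pos (le_max_right _ _)
  obtain ⟨ξ₀, hξ₀, H⟩ := twoLevel_tube_nearTop_of_coreLevel hd0 hd2 hΛ
  obtain ⟨T₁, hT₁, hcore⟩ := Hξ ξ₀ hξ₀
  refine H ν T hν hT u p hcl hLH hdec hbd hax (δ / 2) T₁ (half_pos hδ) hT₁
    (fun t ht _ x hx hxδ _ => ?_) (fun t ht htT₁ x hx hxδ hxcore => hcore t ht htT₁ x hx (by linarith) hxcore)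
  -- the gate gives the Reynolds gate `max C 1` on `r ≤ δ/2 < δ`
  have h1 := hgate t ht x (by linarith)
  rw [radialVelocity_eq_div']
  have h2 : -(ν * max C 1 / cylRadius x) ≤ -(C * ν) / cylRadius x := by
    rw [neg_div]
    refine neg_le_neg (div_le_div_of_nonneg_right ?_ hx.le)
    nlinarith [le_max_left C 1]
  exact h2.trans (div_le_div_of_nonneg_right h1 hx.le)

/-- **Per-solution equivalence.** In the standing class under the gate (any `C`): the solution extends smoothly
past `T` iff its core inflow Reynolds number becomes subcritical (`< 2`) in every parabolic core near `T` — iff it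
tends to `0` there (every level `d₀ > 0`). [new] -/
theorem hasSmoothExtensionPast_iff_subcriticalCoreReynolds {ν T C δ : ℝ} (hν : 0 < ν) (hT : 0 < T) (hδ : 0 < δ)
    {u : ℝ → EuclideanSpace ℝ (Fin 3) → EuclideanSpace ℝ (Fin 3)} {p : ℝ → EuclideanSpace ℝ (Fin 3) → ℝ}
    (hcl : IsClassicalNSSolutionOn (Ico 0 T) ν 0 u p) (hLH : IsLerayHopfOn T ν 0 (u 0) u)
    (hbd : ∀ T' < T, ∃ M : ℝ, ∀ t ∈ Icc 0 T', ∀ x, ‖u t x‖ ≤ M)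
    (hax : ∀ t ∈ Ico 0 T, IsAxisymmetric (u t)) (hdec : HasRapidSpatialDecay (u 0))
    (hgate : ∀ t ∈ Ico 0 T, ∀ x : EuclideanSpace ℝ (Fin 3), cylRadius x < δ →
      -(C * ν) ≤ x 0 * u t x 0 + x 1 * u t x 1) :
    (HasSmoothExtensionPast ν 0 u T ↔
      ∃ d₀ : ℝ, 0 < d₀ ∧ d₀ < 2 ∧ ∀ ξ : ℝ, 0 < ξ → ∃ T₁ : ℝ, T₁ < T ∧
        ∀ t ∈ Ico 0 T, T₁ ≤ t → ∀ x : EuclideanSpace ℝ (Fin 3), 0 < cylRadius x → cylRadius x < δ →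
          cylRadius x < ξ * √(ν * (T - t)) → -(ν * d₀ / cylRadius x) ≤ radialVelocity (u t) x) ∧
    (HasSmoothExtensionPast ν 0 u T ↔
      ∀ d₀ : ℝ, 0 < d₀ → ∀ ξ : ℝ, 0 < ξ → ∃ T₁ : ℝ, T₁ < T ∧
        ∀ t ∈ Ico 0 T, T₁ ≤ t → ∀ x : EuclideanSpace ℝ (Fin 3), 0 < cylRadius x → cylRadius x < δ →
          cylRadius x < ξ * √(ν * (T - t)) → -(ν * d₀ / cylRadius x) ≤ radialVelocity (u t) x) := by
  have hnec : HasSmoothExtensionPast ν 0 u T → ∃ B : ℝ, ∀ t ∈ Ico 0 T, ∀ x, ‖u t x‖ ≤ B := fun hext =>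
    CorePartialTypeI.exists_bound_of_hasSmoothExtensionPast hν hT hcl hLH hbd hax hext
  refine ⟨⟨fun hext => (hnec hext).elim fun B hB =>
      ⟨1, one_pos, by norm_num, vanishingCoreReynolds_of_bound hν hT hB 1 one_pos⟩,
    fun hSCR => hasSmoothExtensionPast_of_subcriticalCoreReynolds hν hT hδ hcl hLH hbd hax hdec hgate hSCR⟩,
    ⟨fun hext => (hnec hext).elim fun B hB => vanishingCoreReynolds_of_bound hν hT hB, fun hall => ?_⟩⟩
  exact hasSmoothExtensionPast_of_subcriticalCoreReynolds hν hT hδ hcl hLH hbd hax hdec hgate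
    ⟨1, one_pos, by norm_num, hall 1 one_pos⟩

/-! ### §3 The equivalence certificate, BY NAME -/

/-- **SCR ⇒ `OneSidedRadialCriterion`, BY NAME** (the line's composition with the registered research stub
`stub_subcriticalCoreReynolds` taken as a hypothesis — its literal type, binders made explicit). Nothing is closed.
[new; the line file's `OneSidedRadialCriterion_of`] -/
theorem oneSidedRadialCriterion_of_subcriticalCoreReynolds
    (hSCR : ∀ (ν T : ℝ), 0 < ν → 0 < T →
      ∀ (u : ℝ → EuclideanSpace ℝ (Fin 3) → EuclideanSpace ℝ (Fin 3)) (p : ℝ → EuclideanSpace ℝ (Fin 3) → ℝ),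
      IsClassicalNSSolutionOn (Ico 0 T) ν 0 u p → IsLerayHopfOn T ν 0 (u 0) u →
      (∀ T' < T, ∃ M : ℝ, ∀ t ∈ Icc 0 T', ∀ x, ‖u t x‖ ≤ M) →
      (∀ t ∈ Ico 0 T, IsAxisymmetric (u t)) → HasRapidSpatialDecay (u 0) →
      ∀ (C δ : ℝ), 0 < δ →
      (∀ t ∈ Ico 0 T, ∀ x : EuclideanSpace ℝ (Fin 3), cylRadius x < δ →
        -(C * ν) ≤ x 0 * u t x 0 + x 1 * u t x 1) →
      ∃ d₀ : ℝ, 0 < d₀ ∧ d₀ < 2 ∧ ∀ ξ : ℝ, 0 < ξ → ∃ T₁ : ℝ, T₁ < T ∧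
        ∀ t ∈ Ico 0 T, T₁ ≤ t → ∀ x : EuclideanSpace ℝ (Fin 3), 0 < cylRadius x → cylRadius x < δ →
          cylRadius x < ξ * √(ν * (T - t)) → -(ν * d₀ / cylRadius x) ≤ radialVelocity (u t) x) :
    OneSidedRadialCriterion := by
  intro ν T hν hT u p hcl hLH hbd hax hdec hin
  obtain ⟨C, δ, hδ, hgate⟩ := hin
  exact hasSmoothExtensionPast_of_subcriticalCoreReynolds hν hT hδ hcl hLH hbd hax hdec hgate
    (hSCR ν T hν hT u p hcl hLH hbd hax hdec C δ hδ hgate)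

/-- **`OneSidedRadialCriterion` ⇒ SCR, BY NAME** (stub shape). [new] -/
theorem subcriticalCoreReynolds_of_oneSidedRadialCriterion (hX1 : OneSidedRadialCriterion) :
    ∀ (ν T : ℝ), 0 < ν → 0 < T →
      ∀ (u : ℝ → EuclideanSpace ℝ (Fin 3) → EuclideanSpace ℝ (Fin 3)) (p : ℝ → EuclideanSpace ℝ (Fin 3) → ℝ),
      IsClassicalNSSolutionOn (Ico 0 T) ν 0 u p → IsLerayHopfOn T ν 0 (u 0) u →
      (∀ T' < T, ∃ M : ℝ, ∀ t ∈ Icc 0 T', ∀ x, ‖u t x‖ ≤ M) →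
      (∀ t ∈ Ico 0 T, IsAxisymmetric (u t)) → HasRapidSpatialDecay (u 0) →
      ∀ (C δ : ℝ), 0 < δ →
      (∀ t ∈ Ico 0 T, ∀ x : EuclideanSpace ℝ (Fin 3), cylRadius x < δ →
        -(C * ν) ≤ x 0 * u t x 0 + x 1 * u t x 1) →
      ∃ d₀ : ℝ, 0 < d₀ ∧ d₀ < 2 ∧ ∀ ξ : ℝ, 0 < ξ → ∃ T₁ : ℝ, T₁ < T ∧
        ∀ t ∈ Ico 0 T, T₁ ≤ t → ∀ x : EuclideanSpace ℝ (Fin 3), 0 < cylRadius x → cylRadius x < δ →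
          cylRadius x < ξ * √(ν * (T - t)) → -(ν * d₀ / cylRadius x) ≤ radialVelocity (u t) x := by
  intro ν T hν hT u p hcl hLH hbd hax hdec C δ hδ hgate
  obtain ⟨B, hB⟩ := CorePartialTypeI.exists_bound_of_hasSmoothExtensionPast hν hT hcl hLH hbd hax
    (hX1 ν T hν hT u p hcl hLH hbd hax hdec ⟨C, δ, hδ, hgate⟩)
  exact ⟨1, one_pos, by norm_num, vanishingCoreReynolds_of_bound hν hT hB 1 one_pos⟩

/-- **EQUIVALENCE CERTIFICATE, BY NAME: `OneSidedRadialCriterion ↔` SCR** (the registered research stub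
`stub_subcriticalCoreReynolds` of the line `subcritical_core_reynolds`, universally closed).  The stub carries exactly
the strength of the route item ⟨19059⟩. Nothing is closed. [new] -/
theorem oneSidedRadialCriterion_iff_subcriticalCoreReynolds :
    OneSidedRadialCriterion ↔
    ∀ (ν T : ℝ), 0 < ν → 0 < T →
      ∀ (u : ℝ → EuclideanSpace ℝ (Fin 3) → EuclideanSpace ℝ (Fin 3)) (p : ℝ → EuclideanSpace ℝ (Fin 3) → ℝ),
      IsClassicalNSSolutionOn (Ico 0 T) ν 0 u p → IsLerayHopfOn T ν 0 (u 0) u →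
      (∀ T' < T, ∃ M : ℝ, ∀ t ∈ Icc 0 T', ∀ x, ‖u t x‖ ≤ M) →
      (∀ t ∈ Ico 0 T, IsAxisymmetric (u t)) → HasRapidSpatialDecay (u 0) →
      ∀ (C δ : ℝ), 0 < δ →
      (∀ t ∈ Ico 0 T, ∀ x : EuclideanSpace ℝ (Fin 3), cylRadius x < δ →
        -(C * ν) ≤ x 0 * u t x 0 + x 1 * u t x 1) →
      ∃ d₀ : ℝ, 0 < d₀ ∧ d₀ < 2 ∧ ∀ ξ : ℝ, 0 < ξ → ∃ T₁ : ℝ, T₁ < T ∧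
        ∀ t ∈ Ico 0 T, T₁ ≤ t → ∀ x : EuclideanSpace ℝ (Fin 3), 0 < cylRadius x → cylRadius x < δ →
          cylRadius x < ξ * √(ν * (T - t)) → -(ν * d₀ / cylRadius x) ≤ radialVelocity (u t) x :=
  ⟨subcriticalCoreReynolds_of_oneSidedRadialCriterion, oneSidedRadialCriterion_of_subcriticalCoreReynolds⟩

/-- **`OneSidedRadialCriterion ↔` VANISHING core Reynolds number, BY NAME.**  The formally strongest door (every level
`d₀ > 0`: the core inflow Reynolds number tends to `0` near `T` in every parabolic core) is ALSO equivalent to the crux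
— so the self-improvement `C ↦ d₀ < 2` asked by the stub and the full decay `C ↦ 0⁺` are one and the same
statement.  Nothing is closed. [new] -/
theorem oneSidedRadialCriterion_iff_vanishingCoreReynolds :
    OneSidedRadialCriterion ↔
    ∀ (ν T : ℝ), 0 < ν → 0 < T →
      ∀ (u : ℝ → EuclideanSpace ℝ (Fin 3) → EuclideanSpace ℝ (Fin 3)) (p : ℝ → EuclideanSpace ℝ (Fin 3) → ℝ),
      IsClassicalNSSolutionOn (Ico 0 T) ν 0 u p → IsLerayHopfOn T ν 0 (u 0) u →
      (∀ T' < T, ∃ M : ℝ, ∀ t ∈ Icc 0 T', ∀ x, ‖u t x‖ ≤ M) →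
      (∀ t ∈ Ico 0 T, IsAxisymmetric (u t)) → HasRapidSpatialDecay (u 0) →
      ∀ (C δ : ℝ), 0 < δ →
      (∀ t ∈ Ico 0 T, ∀ x : EuclideanSpace ℝ (Fin 3), cylRadius x < δ →
        -(C * ν) ≤ x 0 * u t x 0 + x 1 * u t x 1) →
      ∀ d₀ : ℝ, 0 < d₀ → ∀ ξ : ℝ, 0 < ξ → ∃ T₁ : ℝ, T₁ < T ∧
        ∀ t ∈ Ico 0 T, T₁ ≤ t → ∀ x : EuclideanSpace ℝ (Fin 3), 0 < cylRadius x → cylRadius x < δ →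
          cylRadius x < ξ * √(ν * (T - t)) → -(ν * d₀ / cylRadius x) ≤ radialVelocity (u t) x := by
  refine ⟨fun hX1 ν T hν hT u p hcl hLH hbd hax hdec C δ hδ hgate => ?_, fun hall => ?_⟩
  · exact vanishingCoreReynolds_of_hasSmoothExtensionPast hν hT hcl hLH hbd hax
      (hX1 ν T hν hT u p hcl hLH hbd hax hdec ⟨C, δ, hδ, hgate⟩)
  · refine oneSidedRadialCriterion_of_subcriticalCoreReynolds
      fun ν T hν hT u p hcl hLH hbd hax hdec C δ hδ hgate => ?_
    exact ⟨1, one_pos, by norm_num, hall ν T hν hT u p hcl hLH hbd hax hdec C δ hδ hgate 1 one_pos⟩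

end Summit.NavierStokesRegularity.NavierStokesRegularity.Theorems.SubcriticalCoreReynolds

end
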